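import Literature.Analysis.FluidPDE.LeiZhang2017AxisymmetricCriteria
import Literature.Analysis.FluidPDE.LerayHopfBoundedWindowRegular
import Literature.Analysis.FluidPDE.KNSSSwirlTransport
import HarnessLib

/-!
# Q. S. Zhang 2026: partial Type I axisymmetric solutions do not blow up

Topic `Literature/Analysis/FluidPDE`; one named fact (a result in print that the tree has not
proved, `def … : Prop`, D-0014) with proved corollaries, typed for the ns-blowup cell's
profile-search kill table (KILLSHEET-B §1 row R8 = KILLSHEET row K29, «(not typed)» before this
file): the criterion every axisymmetric blow-up candidate of zone Z1 must VIOLATE — supercritical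
INWARD radial velocity.

Qi S. Zhang, *On partial type I solutions to the axially symmetric Navier–Stokes equations*,
arXiv:2604.07785 (2026), §1 (references to the arXiv version):

> **Theorem 1.1.** Let `v = v(x, t)` be a Leray–Hopf solution of the axially symmetric
> Navier–Stokes equations in `ℝ³ × [0, ∞)`. Suppose, (a). the initial value `v₀ = v(·, 0)` is in
> the space `L²(ℝ³) ∩ L^∞(ℝ³) ∩ C³(ℝ³)`, (b). `r v_θ(·, 0) ∈ L^∞(ℝ³)`, (c). `v` is partially type I,
> i.e.: `v_r(x, t) ≥ -c/√(T - t)`, `(x, t) ∈ ℝ³ × [0, T)` for any given constants `c > 0` and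
> `T > 0`. Then `v` is bounded and smooth in `ℝ³ × [0, T]`.

(Abstract: "such solution does not blow up at time `T` … This extends a well known result …
under the full type I condition: `|v(x, t)| ≤ C/√(T - t)`. The result also confirms the physical
intuition that potential blow ups for ASNS are caused by super-critical inward radial velocity."
§1 after (1.3): viscosity `1`, no force; `v = v_r e_r + v_θ e_θ + v₃ e₃`, `Γ = r v_θ`.  Proof,
§3 Step 1: "It is well known that `v` is smooth at least in a short time interval. So we can
suppose that `v` is smooth in the time interval `(0, T)`. We will show that it is smooth in
`(0, T]`" — a modulus of continuity for `Γ` at the axis from a one-dimensional drift–diffusion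
comparison function, then the `Γ`-continuity criteria of Chen–Fang–Zhang / Lei–Zhang / Wei.)

* `Zhang2026_partialTypeI_regularity` — **Theorem 1.1** as a named fact.

## Rendering (a special case of the printed statement, never stronger)

Exactly the rendering of the neighbouring GLOBAL axisymmetric criteria
`Wei2016_logModulus_regularity` / `LeiZhang2017_logModulus_regularity`
(`LeiZhang2017AxisymmetricCriteria.lean`): a classical solution `(u, p)` of Navier–Stokes
(`ν = 1`, `f = 0`) on `[0, T) × ℝ³` (`IsClassicalNSSolutionOn (Ico 0 T) 1 0 u p`; printed Step 1:
`v` smooth on `(0, T)`) which is Leray–Hopf on `[0, T)` from its datum (`IsLerayHopfOn T 1 0 (u 0) u`;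
printed: "a Leray–Hopf solution … in `ℝ³ × [0, ∞)`" — the global Leray–Hopf continuation of `u`
past `T` exists and coincides with `u` on `[0, T)` by weak–strong uniqueness, so restricting the
hypothesis to `[0, T)` loses nothing), the datum rapidly decaying (`HasRapidSpatialDecay (u 0)`,
Fefferman's class — a SUBCLASS of the printed `L² ∩ L^∞ ∩ C³`, hypothesis (a)), every slice
`u t`, `0 ≤ t < T`, axisymmetric about the `x₃`-axis (`IsAxisymmetric`; the printed "solution of
the axially symmetric Navier–Stokes equations"), hypothesis (b) verbatim as
`‖Γ₀‖_{L^∞} < ∞` with `Γ₀ = swirl (u 0) = r u_θ(·, 0)` (automatic for rapidly decaying data,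
`HasRapidSpatialDecay.eLpNorm_swirl_lt_top`, but kept as printed), and hypothesis (c) verbatim with
the accepted `radialVelocity u x = ⟪u x, e_r x⟫` (`AxisymmetricEuler.lean`; junk value `0` on the
axis, where the printed `v_r` vanishes too): `-c/√(T - t) ≤ v_r(x, t)` for ALL `x ∈ ℝ³` and ALL
`t ∈ [0, T)`.  The conclusion "`v` is bounded and smooth in `ℝ³ × [0, T]`" is rendered by its
first half, **`v` is bounded on `[0, T) × ℝ³`** (`∃ M, ∀ t ∈ [0, T), ∀ x, ‖u t x‖ ≤ M`), which is
what the cell's kill rows consume and from which the tree PROVES the continuation form used by the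
sibling criteria (`Zhang2026_partialTypeI_regularity.hasSmoothExtensionPast`: a Leray–Hopf
solution essentially bounded on `(0, T) × ℝ³` is `H¹`-regular on `(0, T]`,
`IsLerayHopfOn.isH1RegularOn_Ioc_of_ae_bound`, and an `H¹`-regular classical Leray–Hopf solution
extends smoothly past `T`, `IsClassicalNSSolutionOn.hasSmoothExtensionPast_of_isH1RegularOn_Ioc`;
Robinson–Rodrigo–Sadowski 2016, Thm. 8.17 and proof of Thm. 12.3).  Viscosity `ν = 1` as printed.

Proved here besides that corollary: `|v_r| ≤ |v|` (`abs_radialVelocity_le_norm`), so the full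
Type I bound `|v| ≤ c/√(T - t)` on `[0, T) × ℝ³` implies the partial one
(`partialTypeI_of_norm_le`: the theorem "extends" the Type I exclusion, as the abstract says), and
the contrapositive the kill table quotes — **an axisymmetric classical Leray–Hopf solution from a
rapidly decaying datum that does NOT extend past `T` has, for every `c > 0`, a point of
`[0, T) × ℝ³` with `v_r < -c/√(T - t)`** (`radialInflow_unbounded_of_not_hasSmoothExtensionPast`):
"an axisymmetric blow-up needs supercritical inward radial velocity".

Not restated: the one-dimensional comparison results of §2 (Thm. 2.1 on the half line and the
sharpness example), the modulus-of-continuity Lemma of §3.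

## Mathlib / tree search

Mathlib has no Navier–Stokes theory.  `lean search '2604.07785|Zhang2026|partialTypeI|radialInflow'`:
no declaration (2026-08-26); the bib key `Zhang2026` of `references.bib` is an unrelated book, hence
the key `Zhang2026PartialTypeI` below.  Reused: `IsClassicalNSSolutionOn`, `HasSmoothExtensionPast`,
`IsMaximalSmoothSolution` (`ClassicalSolution.lean`); `IsLerayHopfOn` (`LerayHopf.lean`);
`HasRapidSpatialDecay` (`NSWave0.lean`); `IsAxisymmetric`, `radialVelocity`, `eR`, `swirl`,
`cylRadius` (`AxisymmetricEuler.lean`); `norm_eR_le_one` (`KNSSSwirlTransport.lean`);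
`HasRapidSpatialDecay.eLpNorm_swirl_lt_top` (`LeiZhang2017AxisymmetricCriteria.lean`);
`IsLerayHopfOn.isH1RegularOn_Ioc_of_ae_bound`,
`IsClassicalNSSolutionOn.hasSmoothExtensionPast_of_isH1RegularOn_Ioc`
(`LerayHopfBoundedWindowRegular.lean`).  Neighbours: the full Type I exclusion
`knss_no_axisymmetric_typeI` (`Axisymmetric.lean`, `_holds`), the swirl criteria
`Wei2016_logModulus_regularity`, `LeiZhang2017_logModulus_regularity`.

## References

* Qi S. Zhang, *On partial type I solutions to the axially symmetric Navier–Stokes equations*,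
  arXiv:2604.07785 (2026): Abstract, Thm. 1.1 (§1), §3 Step 1. [`Zhang2026PartialTypeI`]
* J. C. Robinson, J. L. Rodrigo, W. Sadowski, *The Three-Dimensional Navier–Stokes Equations*,
  CUP (2016), Thm. 8.17, proof of Thm. 12.3. [`RobinsonRodrigoSadowski2016`]
* G. Koch, N. Nadirashvili, G. Seregin, V. Šverák, Acta Math. 203 (2009), Thms. 6.1–6.2;
  G. Seregin, V. Šverák, Comm. PDE 34 (2009), Thms. 1.1–1.2 (the full Type I exclusion the
  theorem extends). [`KochNadirashviliSereginSverak2009`, `SereginSverak2009`]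
-/

noncomputable section

open MeasureTheory Set Function Filter Topology TopologicalSpace
open scoped NNReal ENNReal RealInnerProductSpace

namespace Literature.Analysis.FluidPDE

/-- Local notation for physical space `ℝ³ = EuclideanSpace ℝ (Fin 3)`. -/
local notation "ℝ³" => EuclideanSpace ℝ (Fin 3)

/-! ### The radial velocity is dominated by the speed -/

/-- `|v_r(x)| = |⟪v(x), e_r(x)⟫| ≤ |v(x)|`: the radial component of the orthonormal cylindrical
decomposition `v = v_r e_r + v_θ e_θ + v_3 e_3` (KNSS 2009, §1, (1.5)–(1.6); Zhang 2026, §1) is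
dominated by the speed (Cauchy–Schwarz with `|e_r| ≤ 1`; on the axis both sides compare as
`0 ≤ |v(x)|`). [cite: KochNadirashviliSereginSverak2009, §1 (1.5)–(1.6) (cylindrical components)] -/
theorem abs_radialVelocity_le_norm (u : ℝ³ → ℝ³) (x : ℝ³) : |radialVelocity u x| ≤ ‖u x‖ :=
  calc |radialVelocity u x| ≤ ‖u x‖ * ‖eR x‖ := abs_real_inner_le_norm _ _
    _ ≤ ‖u x‖ * 1 := by gcongr; exact norm_eR_le_one x
    _ = ‖u x‖ := mul_one _

/-- Hence `-|v(x)| ≤ v_r(x)` (KNSS 2009, §1, (1.5)–(1.6)).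
[cite: KochNadirashviliSereginSverak2009, §1 (1.5)–(1.6) (cylindrical components)] -/
theorem neg_norm_le_radialVelocity (u : ℝ³ → ℝ³) (x : ℝ³) : -‖u x‖ ≤ radialVelocity u x :=
  (abs_le.mp (abs_radialVelocity_le_norm u x)).1

/-- **The full Type I bound implies the partial one** (Zhang 2026, Abstract: Thm. 1.1 "extends a
well known result … under the full type I condition `|v(x, t)| ≤ C/√(T - t)`"): if
`|v(x, t)| ≤ c/√(T - t)` on `[0, T) × ℝ³` then `v_r(x, t) ≥ -c/√(T - t)` there.
[cite: Zhang2026PartialTypeI, Abstract and Thm. 1.1 (c)] -/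
theorem partialTypeI_of_norm_le {u : ℝ → ℝ³ → ℝ³} {T c : ℝ}
    (h : ∀ t ∈ Ico 0 T, ∀ x, ‖u t x‖ ≤ c / Real.sqrt (T - t)) :
    ∀ t ∈ Ico 0 T, ∀ x, -(c / Real.sqrt (T - t)) ≤ radialVelocity (u t) x := fun t ht x =>
  (neg_le_neg (h t ht x)).trans (neg_norm_le_radialVelocity (u t) x)

/-! ### The named fact -/

/-- **Q. S. Zhang 2026, Theorem 1.1 (partial Type I axisymmetric Leray–Hopf solutions are
bounded up to `T`).**  "Let `v` be a Leray–Hopf solution of the axially symmetric Navier–Stokes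
equations in `ℝ³ × [0, ∞)`. Suppose (a) `v₀ ∈ L² ∩ L^∞ ∩ C³`, (b) `r v_θ(·, 0) ∈ L^∞`, (c) `v` is
partially type I: `v_r(x, t) ≥ -c/√(T - t)` for `(x, t) ∈ ℝ³ × [0, T)`, for any given constants
`c > 0`, `T > 0`. Then `v` is bounded and smooth in `ℝ³ × [0, T]`" (`ν = 1`, no force).  Rendered
(module docstring) for a classical solution on `[0, T) × ℝ³` which is Leray–Hopf on `[0, T)` from
a rapidly decaying datum with axisymmetric slices, with (b) as `‖swirl (u 0)‖_{L^∞} < ∞` and (c)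
through the accepted `radialVelocity`; conclusion: `v` is BOUNDED on `[0, T) × ℝ³` (the
continuation past `T` is then the proved corollary `….hasSmoothExtensionPast`).
[cite: Zhang2026PartialTypeI, Thm. 1.1 (arXiv:2604.07785 §1) with §3 Step 1] -/
def Zhang2026_partialTypeI_regularity : Prop :=
  ∀ (c T : ℝ), 0 < c → 0 < T → ∀ (u : ℝ → ℝ³ → ℝ³) (p : ℝ → ℝ³ → ℝ),
    IsClassicalNSSolutionOn (Ico 0 T) 1 0 u p → IsLerayHopfOn T 1 0 (u 0) u →
    HasRapidSpatialDecay (u 0) → (∀ t ∈ Ico 0 T, IsAxisymmetric (u t)) →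
    eLpNorm (swirl (u 0)) ∞ volume < ∞ →
    (∀ t ∈ Ico 0 T, ∀ x : ℝ³, -(c / Real.sqrt (T - t)) ≤ radialVelocity (u t) x) →
    ∃ M : ℝ, ∀ t ∈ Ico 0 T, ∀ x : ℝ³, ‖u t x‖ ≤ M

/-! ### API -/

namespace Zhang2026_partialTypeI_regularity

variable {u : ℝ → ℝ³ → ℝ³} {p : ℝ → ℝ³ → ℝ} {c T : ℝ}

/-- The fact applied: under (a)–(c) the velocity is bounded on `[0, T) × ℝ³`.
[cite: Zhang2026PartialTypeI, Thm. 1.1] -/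
theorem bounded (h : Zhang2026_partialTypeI_regularity) (hc : 0 < c) (hT : 0 < T)
    (hcl : IsClassicalNSSolutionOn (Ico 0 T) 1 0 u p) (hLH : IsLerayHopfOn T 1 0 (u 0) u)
    (hdec : HasRapidSpatialDecay (u 0)) (hax : ∀ t ∈ Ico 0 T, IsAxisymmetric (u t))
    (hΓ : eLpNorm (swirl (u 0)) ∞ volume < ∞)
    (hr : ∀ t ∈ Ico 0 T, ∀ x : ℝ³, -(c / Real.sqrt (T - t)) ≤ radialVelocity (u t) x) :
    ∃ M : ℝ, ∀ t ∈ Ico 0 T, ∀ x : ℝ³, ‖u t x‖ ≤ M :=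
  h c T hc hT u p hcl hLH hdec hax hΓ hr

/-- **Continuation form** ("such solution does not blow up at time `T`", Abstract; "`v` is …
smooth in `ℝ³ × [0, T]`", Thm. 1.1): under (a)–(c) the classical solution extends smoothly past
`T`.  PROVED from the fact: boundedness on `(0, T) × ℝ³` makes the Leray–Hopf solution
`H¹`-regular on `(0, T]` (`IsLerayHopfOn.isH1RegularOn_Ioc_of_ae_bound`), and an `H¹`-regular
classical Leray–Hopf solution continues (`IsClassicalNSSolutionOn.hasSmoothExtensionPast_of_isH1RegularOn_Ioc`).
[cite: Zhang2026PartialTypeI, Thm. 1.1 and Abstract; RobinsonRodrigoSadowski2016, Thm. 8.17 and proof of Thm. 12.3] -/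
theorem hasSmoothExtensionPast (h : Zhang2026_partialTypeI_regularity) (hc : 0 < c) (hT : 0 < T)
    (hcl : IsClassicalNSSolutionOn (Ico 0 T) 1 0 u p) (hLH : IsLerayHopfOn T 1 0 (u 0) u)
    (hdec : HasRapidSpatialDecay (u 0)) (hax : ∀ t ∈ Ico 0 T, IsAxisymmetric (u t))
    (hΓ : eLpNorm (swirl (u 0)) ∞ volume < ∞)
    (hr : ∀ t ∈ Ico 0 T, ∀ x : ℝ³, -(c / Real.sqrt (T - t)) ≤ radialVelocity (u t) x) :
    HasSmoothExtensionPast 1 0 u T := by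
  obtain ⟨M, hM⟩ := h c T hc hT u p hcl hLH hdec hax hΓ hr
  have hreg : IsH1RegularOn (Ioc 0 T) u :=
    hLH.isH1RegularOn_Ioc_of_ae_bound one_pos hT (M := M) fun t ht =>
      ae_of_all _ fun x => hM t ⟨ht.1.le, ht.2⟩ x
  exact hcl.hasSmoothExtensionPast_of_isH1RegularOn_Ioc one_pos hT hLH hreg

/-- The hypothesis (b) is automatic for rapidly decaying data, so the continuation form holds
with (a), (c) and axisymmetry alone. [cite: Zhang2026PartialTypeI, Thm. 1.1] -/
theorem hasSmoothExtensionPast' (h : Zhang2026_partialTypeI_regularity) (hc : 0 < c) (hT : 0 < T)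
    (hcl : IsClassicalNSSolutionOn (Ico 0 T) 1 0 u p) (hLH : IsLerayHopfOn T 1 0 (u 0) u)
    (hdec : HasRapidSpatialDecay (u 0)) (hax : ∀ t ∈ Ico 0 T, IsAxisymmetric (u t))
    (hr : ∀ t ∈ Ico 0 T, ∀ x : ℝ³, -(c / Real.sqrt (T - t)) ≤ radialVelocity (u t) x) :
    HasSmoothExtensionPast 1 0 u T :=
  hasSmoothExtensionPast h hc hT hcl hLH hdec hax hdec.eLpNorm_swirl_lt_top hr

/-- **The full Type I case** (Abstract: the theorem "extends" the Type I exclusion of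
Koch–Nadirashvili–Seregin–Šverák / Seregin–Šverák / Chen–Strain–Tsai–Yau): `|v| ≤ c/√(T - t)` on
`[0, T) × ℝ³` forces continuation past `T`. [cite: Zhang2026PartialTypeI, Abstract and Thm. 1.1] -/
theorem hasSmoothExtensionPast_of_typeI (h : Zhang2026_partialTypeI_regularity) (hc : 0 < c)
    (hT : 0 < T) (hcl : IsClassicalNSSolutionOn (Ico 0 T) 1 0 u p)
    (hLH : IsLerayHopfOn T 1 0 (u 0) u) (hdec : HasRapidSpatialDecay (u 0))
    (hax : ∀ t ∈ Ico 0 T, IsAxisymmetric (u t))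
    (hI : ∀ t ∈ Ico 0 T, ∀ x : ℝ³, ‖u t x‖ ≤ c / Real.sqrt (T - t)) :
    HasSmoothExtensionPast 1 0 u T :=
  hasSmoothExtensionPast' h hc hT hcl hLH hdec hax (partialTypeI_of_norm_le hI)

/-- **Contrapositive, the kill-table form** (Abstract: "potential blow ups for ASNS are caused by
super-critical inward radial velocity"): if the axisymmetric classical Leray–Hopf solution from a
rapidly decaying datum does NOT extend smoothly past `T`, then for every `c > 0` there is a point
of `[0, T) × ℝ³` where `v_r < -c/√(T - t)`, i.e. `inf_x v_r(x, t) √(T - t)` is unbounded below on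
`[0, T)`. [cite: Zhang2026PartialTypeI, Thm. 1.1 and Abstract] -/
theorem radialInflow_unbounded_of_not_hasSmoothExtensionPast (h : Zhang2026_partialTypeI_regularity)
    (hT : 0 < T) (hcl : IsClassicalNSSolutionOn (Ico 0 T) 1 0 u p)
    (hLH : IsLerayHopfOn T 1 0 (u 0) u) (hdec : HasRapidSpatialDecay (u 0))
    (hax : ∀ t ∈ Ico 0 T, IsAxisymmetric (u t)) (hmax : ¬ HasSmoothExtensionPast 1 0 u T) :
    ∀ c : ℝ, 0 < c → ∃ t ∈ Ico 0 T, ∃ x : ℝ³, radialVelocity (u t) x < -(c / Real.sqrt (T - t)) := by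
  intro c hc
  by_contra hcon
  push Not at hcon
  exact hmax (hasSmoothExtensionPast' h hc hT hcl hLH hdec hax hcon)

/-- The same for a maximal smooth solution with lifespan `T` (`IsMaximalSmoothSolution`, the
blow-up vocabulary of `leray_blowup_rate`). [cite: Zhang2026PartialTypeI, Thm. 1.1 and Abstract] -/
theorem radialInflow_unbounded_of_isMaximalSmoothSolution (h : Zhang2026_partialTypeI_regularity)
    (hT : 0 < T) (hmax : IsMaximalSmoothSolution 1 0 u p T)
    (hLH : IsLerayHopfOn T 1 0 (u 0) u) (hdec : HasRapidSpatialDecay (u 0))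
    (hax : ∀ t ∈ Ico 0 T, IsAxisymmetric (u t)) :
    ∀ c : ℝ, 0 < c → ∃ t ∈ Ico 0 T, ∃ x : ℝ³, radialVelocity (u t) x < -(c / Real.sqrt (T - t)) :=
  radialInflow_unbounded_of_not_hasSmoothExtensionPast h hT hmax.1 hLH hdec hax hmax.2

end Zhang2026_partialTypeI_regularity

end Literature.Analysis.FluidPDE

end
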